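import Summits.CriticalPhenomena.Ising3DConformalLimit.Theorems.SynchronousCouplingRotationJoiningIsotropyDefs
import Summits.CriticalPhenomena.Ising3DConformalLimit.Theorems.EnergyNotSigmaSquaredMoebiusLimitExistsLocallyBounded
import Literature.Probability.LatticeModels.CriticalBlockMoments
import Literature.Probability.LatticeModels.CriticalGibbsUniqueness
import HarnessLib

/-!
# Newman's Gaussian bound for block spins of the critical `ℤ³` Ising model
(route `SynchronousCoupling`, crux `RotationJoining`, stmt-CriticalPhenomena-18763, line `SketchIdeator2`,
reshape 2; stub `stub_newmanBlocks` = `NewmanBlocks`)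

For every critical DLR state `μ ∈ 𝒢(β_c(3), 0)` on `ℤ³`, every finite set of sites `S` and every `k`,
the even moments of the block spin `B_S = Σ_{x ∈ S} σ_x` are dominated by the Gaussian ones:
`E_μ[B_S^{2k}] ≤ (2k)!/(2ᵏ k!) · (E_μ[B_S²])ᵏ`.

Proof.
* `𝒢(β_c(3), 0)` is a singleton (`hasUniqueGibbsMeasure_criticalBeta_holds`) whose element is the plus
  state (`exists_plusMeasure_holds`); hence `μ` is a probability measure with
  `criticalCorr 3 n y = ∫ ∏ᵢ σ_{yᵢ} dμ` for every `y` (`criticalCorr_eq_integral_spinMonomial`).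
* `B_S^{n} = Σ_{y ∈ S^{n}} ∏ᵢ σ_{yᵢ}` (`Finset.sum_pow'`), so integrating termwise
  `E_μ[B_S^{2k}] = Σ_{y ∈ S^{2k}} ⟨∏ᵢ σ_{yᵢ}⟩_{β_c}` and `E_μ[B_S²] = Σ_{a,b ∈ S} ⟨σ_aσ_b⟩_{β_c}`.
* NEWMAN'S GAUSSIAN INEQUALITY for the critical state, coincidences allowed
  (`criticalCorr_le_pairingSum`): `⟨∏ᵢ σ_{yᵢ}⟩_{β_c} ≤ 𝒢_k[⟨σσ⟩_{β_c}](y)` termwise, and the smeared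
  Wick law with unit weights (`sum_prod_mul_pairingSum`):
  `Σ_{y ∈ S^{2k}} 𝒢_k[⟨σσ⟩](y) = (2k)!/(2ᵏ k!) (Σ_{a,b ∈ S} ⟨σ_aσ_b⟩)ᵏ`.

References: C. M. Newman, Z. Wahrsch. 33 (1975) 75–93 (Gaussian inequality); M. Aizenman,
H. Duminil-Copin, Ann. Math. 194 (2021), arXiv:1912.07973 §6.3 (lower inequality and its smeared form);
S. Friedli, Y. Velenik (CUP 2017), Thm. 3.17, Thm. 3.28, Thm. 6.26 (plus state as the unique critical
Gibbs measure, linear on local observables). No definitions are introduced.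
-/

noncomputable section

namespace Summit.CriticalPhenomena.Ising3DConformalLimit.Cruxes.RotationJoining.RateSplitting

open MeasureTheory Filter Literature.Probability.LatticeModels
open scoped Topology BigOperators
open Summit.CriticalPhenomena.Ising3DConformalLimit.MoebiusLimitExistsOnlyInteraction
  (criticalCorr_le_pairingSum)

/-! ### The smeared Gaussian bound -/

/-- **Smeared Newman bound for one block** (adapted from `sum_criticalCorr_shift_le` of
`Theorems/HyperoctahedralRPExistsScaleCovariantLimitBlockMomentBounded.lean`, general finite `S`):
`Σ_{y ∈ S^{2k}} ⟨∏ᵢ σ_{yᵢ}⟩_{β_c} ≤ (2k)!/(2ᵏ k!) · (Σ_{a,b ∈ S} ⟨σ_aσ_b⟩_{β_c})ᵏ` — Newman's Gaussian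
inequality `⟨∏σ⟩ ≤ 𝒢_k[⟨σσ⟩]` termwise and the smeared Wick law with unit weights.
[cite: AizenmanDuminilCopinAnnals2021, arXiv:1912.07973 §6.3, first display, lower inequality (p. 26)] -/
private theorem stub_newmanBlocks_sum_criticalCorr_le (k : ℕ) (S : Finset (Site 3)) :
    ∑ y ∈ Fintype.piFinset (fun _ : Fin (2 * k) => S), criticalCorr 3 (2 * k) y ≤
      ((2 * k).factorial : ℝ) / (2 ^ k * k.factorial) *
        (∑ a ∈ S, ∑ b ∈ S, criticalCorr 3 2 ![a, b]) ^ k := by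
  have hW := sum_prod_mul_pairingSum S (fun _ => (1 : ℝ))
    (fun a b => criticalCorr 3 2 ![a, b]) k
  simp only [Finset.prod_const_one, one_mul] at hW
  rw [← hW]
  exact Finset.sum_le_sum fun y _ => criticalCorr_le_pairingSum k y

/-! ### Identification of the critical state -/

/-- **Identification of the critical state.** Every `μ ∈ 𝒢(β_c(3), 0)` is the plus state: a
probability measure with `⟨σ_A⟩_μ = ⟨σ_A⟩⁺_{β_c(3),0}` for every finite `A`
(`hasUniqueGibbsMeasure_criticalBeta_holds`, `exists_plusMeasure_holds`).
[cite: FriedliVelenik2017, Thm. 3.28 with Prop. 3.29 / Thm. 6.63] -/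
private theorem stub_newmanBlocks_critical_state {μ : Measure (SpinConfig (Site 3))}
    (hμ : μ ∈ isingGibbsMeasures 3 (criticalBeta 3) 0) :
    IsProbabilityMeasure μ ∧
      ∀ A : Finset (Site 3), spinCorr μ A = plusCorr 3 (criticalBeta 3) 0 A := by
  obtain ⟨μp, hμp, -, hcorr⟩ :=
    exists_plusMeasure_holds (d := 3) (β := criticalBeta 3) (h := (0 : ℝ)) (criticalBeta_nonneg 3)
  have huniq := hasUniqueGibbsMeasure_criticalBeta_holds (d := 3) (by norm_num)
  have hμeq : μ = μp := huniq.1 hμ hμp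
  subst hμeq
  exact ⟨((mem_isingGibbsMeasures_iff 3 _ 0 μ).1 hμ).isProbabilityMeasure, hcorr⟩

/-! ### The stub -/

/-- **Newman's Gaussian bound for block spins** (stub 6 of reshape 2, `NewmanBlocks`): for every
critical DLR state `μ` on `ℤ³`, every finite `S ⊆ ℤ³` and every `k`,
`E_μ[(Σ_{x∈S} σ_x)^{2k}] ≤ (2k)!/(2ᵏ k!) · (E_μ[(Σ_{x∈S} σ_x)²])ᵏ`: `μ` is the plus state, both moments
expand into sums of critical correlators over `S^{2k}` resp. `S²`, and the `2k`-point correlators are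
bounded termwise by the pairing sum (`criticalCorr_le_pairingSum`), re-summed by the smeared Wick law
(`sum_prod_mul_pairingSum`).
[cite: AizenmanDuminilCopinAnnals2021, arXiv:1912.07973 §6.3, first display, lower inequality (p. 26)] -/
theorem stub_newmanBlocks : Sig.stub_newmanBlocks := by
  intro μ hμ S k
  obtain ⟨hP, hcorr⟩ := stub_newmanBlocks_critical_state hμ
  -- every spin monomial is bounded by `1`, hence integrable
  have hint : ∀ (n : ℕ) (y : Fin n → Site 3), Integrable (spinMonomial y) μ := fun n y =>
    Integrable.of_bound (measurable_spinMonomial y).aestronglyMeasurable 1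
      (Eventually.of_forall fun s => by
        rw [Real.norm_eq_abs]
        simp [spinMonomial, Finset.abs_prod])
  -- the critical correlators are `μ`-integrals
  have hc : ∀ (n : ℕ) (y : Fin n → Site 3), criticalCorr 3 n y = ∫ σ, spinMonomial y σ ∂μ :=
    fun n y => criticalCorr_eq_integral_spinMonomial hcorr y
  -- powers of the block spin are smeared spin monomials
  have hpow : ∀ (n : ℕ) (σ : SpinConfig (Site 3)), blockSum S σ ^ n =
      ∑ y ∈ Fintype.piFinset (fun _ : Fin n => S), spinMonomial y σ := by
    intro n σ
    simp only [blockSum, spinMonomial]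
    exact Finset.sum_pow' _ _ _
  -- hence the moments are smeared critical correlators
  have hmom : ∀ n : ℕ, ∫ σ, blockSum S σ ^ n ∂μ =
      ∑ y ∈ Fintype.piFinset (fun _ : Fin n => S), criticalCorr 3 n y := by
    intro n
    simp_rw [hpow n]
    rw [integral_finsetSum _ fun y _ => hint _ _]
    exact Finset.sum_congr rfl fun y _ => (hc n y).symm
  -- the second moment as a double sum of two-point correlators
  have hsq : ∀ σ : SpinConfig (Site 3), blockSum S σ ^ 2 =
      ∑ a ∈ S, ∑ b ∈ S, spinMonomial ![a, b] σ := by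
    intro σ
    rw [blockSum, sq, Finset.sum_mul_sum]
    refine Finset.sum_congr rfl fun a _ => Finset.sum_congr rfl fun b _ => ?_
    simp [spinMonomial, Fin.prod_univ_two]
  have h2 : ∫ σ, blockSum S σ ^ 2 ∂μ = ∑ a ∈ S, ∑ b ∈ S, criticalCorr 3 2 ![a, b] := by
    simp_rw [hsq]
    rw [integral_finsetSum _ fun a _ => integrable_finsetSum _ fun b _ => hint 2 ![a, b]]
    refine Finset.sum_congr rfl fun a _ => ?_
    rw [integral_finsetSum _ fun b _ => hint 2 ![a, b]]
    exact Finset.sum_congr rfl fun b _ => (hc 2 ![a, b]).symm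
  rw [hmom (2 * k), h2]
  exact stub_newmanBlocks_sum_criticalCorr_le k S

end Summit.CriticalPhenomena.Ising3DConformalLimit.Cruxes.RotationJoining.RateSplitting

end
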